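import Literature.MathematicalPhysics.QuantumFieldTheory.Balaban1983to89.B6MultiLevelTorusOperatorL0
import Literature.MathematicalPhysics.QuantumFieldTheory.Balaban1983to89.B6Geom246MultiLevelBoxL0
import Literature.MathematicalPhysics.QuantumFieldTheory.Balaban1983to89.B6Ineq261LevelGap
import Mathlib.Analysis.Normed.Group.AddCircle
import Literature.MathematicalPhysics.QuantumFieldTheory.Balaban1983to89.B6Geom246MultiLevelTorus

/-!
# `Balaban1983to89.B6Geom246MultiLevelTorusL0` — LEVEL-0 TWIN (programme G-F3′-L0, director-ym LINE №27 / UV3-NODE §24.5; plan `lit-balaban-r03/G-F3L0-PLAN.md`) of `B6Geom246MultiLevelTorus`: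
the same declarations, SAME NAMES AND STATEMENTS, for nested families WITH print's region `Λ₀ = T ∖ Ω₁` ADMITTED (structures
`B6MultiLevelBoxOperatorL0.Domains` / `B6MultiLevelTorusOperatorL0.TDomains`: levels `0, …, k`, the level-`0` block a single site, `Q′₀ = id`,
finite weight `a₀` — print p.225 (2.14) «Σ_{j=0}^k … (Q′₀λ)(x) = λ(x), x ∈ Λ₀», p.229 «taking a sequence (2.1) … smallest possible domains B^j(Λ_j),
and considering the operator Δ_a defined by (2.19), (2.20) for this sequence»).  Every `D`-free object is the lineage's, consumed BY NAME; no existing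
module is touched; no fact is minted.  Unit `lit-balaban-r03` (B6 fold owner, r03 gen 36); referee ref-4.  THE TWIN'S DOCUMENTATION FOLLOWS
VERBATIM (its «levels 1 … k» / «Ω₁ = X» sentences describe the twin; here `j` runs from `0` and `Ω₁` may be a proper subset).

# `Balaban1983to89.B6Geom246MultiLevelTorus` — [B6] THE BLOCK GEOMETRY `𝔅`, THE DISTANCE (2.46) AND LEMMA 2.1
(2.60)–(2.63) FOR A GENUINE NESTED FAMILY OF DOMAINS ON THE TORUS `T_η` (file T3 of the torus carrier of the multi-level
parametrix: the geometry on which the chain (2.64)–(2.66) of Prop. 2.2 runs for the genuine `k`-level operator `Δ′_a` of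
`B6MultiLevelTorusOperator` on print's carrier `Ω₁ = T_η`; plus the block map of a translation chart, by which every decay
bound proved in a chart of `B6Eq238MultiLevelTorus` is a decay bound on the torus; no existing module is touched; no fact is
minted)

FRAMING (verbatim cell line):
statement-level skeleton of published theorems with citation tags; proofs where landed; nothing here is a claim about the Yang–Mills mass gap

Source under audit (cell pub-balaban / lit-balaban): T. Bałaban, *Propagators and renormalization transformations for
lattice gauge theories. II*, Commun. Math. Phys. **96** (1984) 223–250 [`Balaban1984PropagatorsII`, "B6"], p. 224 [PDF 2]
(2.1)–(2.4) («we admit the case when some domains Ω_j are equal to T_η»), p. 231 [PDF 9] (2.45)–(2.46), p. 233–234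
[PDF 11–12] (2.57)–(2.59), Lemma 2.1 (2.60)–(2.63) (held text `paper:balaban1984-cmp96-propagators-rt-ii`, p0002/p0009/
p0011/p0012); T. Bałaban, *Regularity and decay of lattice Green's functions*, Commun. Math. Phys. **89** (1983) 571–597
[`Balaban1983RegularityDecay`], p. 572 (the torus `T_η` with periodic conditions).  Unit `lit-balaban-p21` (Phase-2 proof
seat p21 gen 15), HOME `run/shared/lean/pub/lit-balaban/`, B6 fold owner r03, referee ref-4.  Box sibling (consumed BY
NAME, untouched): `B6Geom246MultiLevelBox` (p21 gen 10: `bset`, `blkOf`, `corner`, `cen`, `bond`, `connected`, `lemma21_box`).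

## WHAT IS PRINTED (p. 231, p. 224, p. 233–234, verbatim up to notation)

p. 231: «Let us define 𝔅 = ⋃_{j=0}^{k} Λ_j, (2.45) and let us introduce the following distance in 𝔅: for y, y′ ∈ 𝔅
d(y, y′) = inf_Γ |Γ|, where Γ is a contour joining y and y′, built of admissible bonds, and |Γ| is the number of these
bonds. A part of Γ contained in B^j(Λ_j) consists of bonds of the lattice Λ_j. (2.46) … d(x, x′) = d(y, y′) if
x ∈ B^j(y), x′ ∈ B^{j′}(y′).»  p. 224: «We consider a sequence of domains Ω₁ ⊃ Ω₂ ⊃ … ⊃ Ω_k, Ω_j ⊂ T_η,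
j = 1, 2, …, k, (2.1) which satisfy the following conditions: … (L^jη)^{−1}dist(Ω_j^c, Ω_{j+1}) > RM, M is a size of big
blocks and R is a big positive integer which will be fixed later. (2.2)» and «Let us notice that we admit the case when
some domains Ω_j are equal to T_η»  p. 234: «Lemma 2.1. … sup_{y∈𝔅} Σ_{y′∈𝔅} e^{−αδ₀d(y,y′)} ≤ c₁(α), (2.61) …
Σ … ≤ c₁(α)^{n+1} e^{−(1−α)δ₀d(y,y′)}. (2.63)»

## WHAT THIS FILE CERTIFIES (kernel-checked; setting of `B6MultiLevelTorusOperator`)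

For a nested family `D : TDomains d ℓ M_h k P R` of domains OF THE TORUS `T_η` (fundamental box `Π_μ[0, N₀_μ)`,
`N₀_μ = (M·L^k)·P_μ`, torus sup-distance `torusSupNorm N₀` in (2.2)); the blocks `𝔅` of the torus are the blocks
`bset D.toDomains` of the fundamental box (`L^j ∣ N₀_μ`: no block is cut by the identification):
* §1 **THE REAL TORUS `Π_μ ℝ/N₀_μℤ`** (Mathlib's `AddCircle`, sup metric of the factors): `toT` (classes of real
  vectors), `norm_coe_int` (the quotient norm of an integer is the lineage's `circAbs`), **`dist_toT_toR`** (the distance of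
  the classes of two lattice points IS `torusSupNorm N₀ (x − y)` — the dictionary between (2.2) of `TDomains` and metric
  balls on the torus), `dist_toT_le` (the projection is 1-Lipschitz), `torusSupNorm_neg`;
* §2 **THE ADMISSIBLE BONDS OF THE TORUS AND (2.46)**: two distinct blocks are joined by a bond iff they TOUCH ACROSS THE
  TORUS (contain sites at torus sup-distance `≤ 1`) (`TouchT`, `bondT`; `bond_le_bondT`: every bond of the fundamental box
  is a bond of the torus, so `distT_le_dist_box`); `d_T` = the graph distance; the `B6.Geometry` `geomT D` (sites `𝔅`,
  scale = level, `d_T`, `L`, `η = 1`) REALISED by the contour system `csysT D` (`realizesT`); admissible contours exist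
  (`connectedT`);
* §3 **THE WALK FORM OF (2.2) ON THE TORUS** `levelGapT`: every chain of admissible bonds of the torus from a block of
  level `< i` to a block of level `> i` has at least `RM` bonds (`M = L·M_h`; `B6Geometry.LevelGap … (RM − 1)`) — from
  `B6MultiLevelTorusOperator.TDomains.sepT` by a walk induction carrying a SITE of level `≥ i + 1` within torus distance `|Γ|·L^i` of the position
  of the starting block (`walk_dispT`; positions `posT` = classes of the block centres on the real torus,
  `dist_site_posT_le`, bond lengths `dist_posT_le_of_adj ≤ L^{max level}`); per-level packing on the torus
  `#S ≤ (2r/L^j + 1)^{d+1}` (`packT`: the labels of the level-`j` blocks within torus distance `r` of a point, shifted by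
  whole periods into one window, are distinct points of a cube of side `2r/L^j`; `label_bounds`);
* §4 **LEMMA 2.1 ON THE TORUS** `lemma21_torus`: (2.60) ∧ (2.61) ∧ (2.62) ∧ (2.63) for `geomT D` with the constant
  `K261 N₀ (d+1) L 1 (αδ₀)` of `B6Ineq261LevelGap` — THE SAME CONSTANT AS THE BOX LINEAGE'S `lemma21_box` — for every
  `N₀ ≥ 1` with `N₀ + 1 ≤ RM` and `e^{−αδ₀}·L^{2(d+1)/N₀} < 1` ((2.59)-shape), by
  `B6Ineq261LevelGap.lemma21_of_realizes_max` with §2–§3; plus the triangle inequality (2.54), `d_T(y, y) = 0`, `d_T ≥ 0`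
  (`triangle_refl_nonneg_T`);
* §5 **THE BLOCK MAP OF A TRANSLATION CHART** (`B6MultiLevelTorusOperatorL0.TDomains.chart s` of file T1, `σ_s = tshift N₀ (N_k·s)`): `blkMap D s`
  sends the block of a chart point `x` to the torus block of `σ_s x` (`blkMap_blkOf`; well defined by `blkOf_tshift_eq`),
  is a BIJECTION of `𝔅(chart s)` onto `𝔅` (`blkMap_injective`, `blkMap_surjective`) and a graph homomorphism
  `bond (D.chart s).toDomains →g bondT D` (`blkHom`: touching box blocks translate to touching torus blocks), hence
  **`distT_le_dist_chart`**: `d_T(blkMap b, blkMap b′) ≤ d_{chart s}(b, b′)` — every decay `e^{−δ·d_{chart}}` certified in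
  a chart is a decay `e^{−δ·d_T}` on the torus (used by file T4 to read the cube bounds of `B6Prop22MultiLevelBox` term
  by term on the torus).

## HONEST SCOPE

Levels `1 … k` with `Ω₁ = T_η` read as in file T1 (print: `j = 0 … k`; `Λ₀`/`a₀ = +∞` not modelled, as in the box
lineage); the admissible bonds are modelled as «the two blocks touch across the torus» (print: «bonds of the lattice Λ_j»
inside `B^j(Λ_j)`, the bonds across `∂B^j(Λ_j)` being unspecified in print); the walk form of (2.2) comes with `RM − 1`
for print's `RM` (our centres are half-integers); the (2.61)-constant is the `L`-dependent series constant of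
`B6Ineq261LevelGap` (print: `c₁(α)`, refuted as typed — `B6Lemma21Counterexample` — and repaired on towers in the r03/p29
lineage); `P_μ ≥ 1` suffices here (the charts of file T2 need `P_μ ≥ 4`).  Nothing is inferred from the manuscript: every
step is kernel-checked; the quoted sentences locate the statements.

DOCFIX (referee ref-4 NOTE S-B6-g55-2, «Gen 55»): the p. 224 chain (2.1) is quoted as printed («Ω₁ ⊃ Ω₂ ⊃ … ⊃ Ω_k,
Ω_j ⊂ T_η», no «T_η ⊃» prefix; the admission of `Ω_j = T_η` is the separate printed sentence); no declaration changed.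
-/

namespace Literature.MathematicalPhysics.QuantumFieldTheory.Balaban1983to89.B6Geom246MultiLevelTorusL0

open Finset Matrix
open Literature.MathematicalPhysics.QuantumFieldTheory.Balaban1983to89.B4ContourShift (supNorm abs_le_supNorm
  supNorm_nonneg exists_supNorm_eq)
open Literature.MathematicalPhysics.QuantumFieldTheory.Balaban1983to89.B4Reflection242 (boxDom mem_boxDom blk)
open Literature.MathematicalPhysics.QuantumFieldTheory.Balaban1983to89.B4TorusKernel.MultiPeriod (circAbs circAbs_nonneg
  circAbs_le_abs circAbs_add_mul abs_add_mul_centre centre torusSupNorm translate torusSupNorm_le_supNorm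
  torusSupNorm_translate torusSupNorm_nonneg translate_apply)
open Literature.MathematicalPhysics.QuantumFieldTheory.Balaban1983to89.B6Geometry (ContourSystem Realizes LevelGap
  dist246 triangle254_of_realizes dist_self_of_realizes dist_nonneg_of_realizes)
open Literature.MathematicalPhysics.QuantumFieldTheory.Balaban1983to89.B6Ineq261LevelGap (K261 K261_nonneg
  lemma21_of_realizes_max levelGap_of_le)
open Literature.MathematicalPhysics.QuantumFieldTheory.Balaban1983to89.B6MultiLevelBoxOperator hiding Domains mlOp_apply
open Literature.MathematicalPhysics.QuantumFieldTheory.Balaban1983to89.B6MultiLevelBoxOperatorL0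
open Literature.MathematicalPhysics.QuantumFieldTheory.Balaban1983to89.B6Geom246MultiLevelBox hiding Touch blkOf blkOf_corner blkOf_eq_iff_blk blkOf_eq_of_blk_i_eq blkOf_val bond bond_adj bset cen connected coord_bounds corner corner_mem csys dist_blkOf_le_box dist_blkOf_le_coord dist_blkOf_le_line dist_cen_le_of_adj dist_cen_le_of_touch dist_le_one_of_near dist_toR_cen_le exists_blkOf_eq geom lemma21_box lev_corner lev_eq_of_blkOf_eq levelGap pack reachable_blkOf reachable_of_near realizes scale_bounds touch_symm triangle_refl_nonneg walk_disp
open Literature.MathematicalPhysics.QuantumFieldTheory.Balaban1983to89.B6Geom246MultiLevelBoxL0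
open Literature.MathematicalPhysics.QuantumFieldTheory.Balaban1983to89.B6MultiLevelTorusOperator hiding TDomains mlOpT_apply mlOpT_eq_reindex_chart mlOpT_mul_reindex mlOpT_tshift
open Literature.MathematicalPhysics.QuantumFieldTheory.Balaban1983to89.B6MultiLevelTorusOperatorL0

open Literature.MathematicalPhysics.QuantumFieldTheory.Balaban1983to89.B6Geom246MultiLevelTorus (TPt toT norm_coe_le_abs norm_coe_le_abs_sub_mul norm_coe_int dist_toT_le dist_toT_toR torusSupNorm_neg)
noncomputable section

variable {d : ℕ}

/-! ## §1 The torus `Π_μ ℝ/N_μℤ` as a metric space: integer points and the torus sup-distance -/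

section TorusMetric

variable {N : Fin (d + 1) → ℕ}

end TorusMetric

/-! ## §2 The admissible bonds of the TORUS, the distance (2.46) and the realised geometry -/

section Bonds

variable {ℓ Mh k R : ℕ} {P : Fin (d + 1) → ℕ} (D : TDomains d ℓ Mh k P R)

/-- two blocks of the torus TOUCH: they contain sites at torus sup-distance `≤ 1` (the blocks `𝔅` of the torus are the
blocks `bset D.toDomains` of the fundamental box — `L^j ∣ N₀`). [cite: Balaban1984PropagatorsII, (2.46) p.231 («admissible bonds»), dictionary] -/
def TouchT (s t : ↥(bset D.toDomains)) : Prop :=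
  ∃ x x' : ↥(boxDom (N0 ℓ Mh k P)), blkOf D.toDomains x = s ∧ blkOf D.toDomains x' = t ∧
    torusSupNorm (N0 ℓ Mh k P) (x.1 - x'.1) ≤ 1

/-- **THE ADMISSIBLE BONDS OF THE TORUS**: distinct touching blocks. [cite: Balaban1984PropagatorsII, (2.46) p.231] -/
def bondT : SimpleGraph ↥(bset D.toDomains) := SimpleGraph.fromRel (TouchT D)

variable {D}

/-- touching is symmetric. [cite: Balaban1984PropagatorsII, (2.46) p.231, dictionary] -/
theorem touchT_symm {s t : ↥(bset D.toDomains)} (h : TouchT D s t) : TouchT D t s := by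
  obtain ⟨x, x', hx, hx', hd⟩ := h
  refine ⟨x', x, hx', hx, ?_⟩
  rw [show x'.1 - x.1 = -(x.1 - x'.1) by abel, torusSupNorm_neg (one_le_of_mem x.2)]
  exact hd

/-- adjacency = distinct and touching. [cite: Balaban1984PropagatorsII, (2.46) p.231] -/
theorem bondT_adj {s t : ↥(bset D.toDomains)} : (bondT D).Adj s t ↔ s ≠ t ∧ TouchT D s t := by
  rw [bondT, SimpleGraph.fromRel_adj]
  constructor
  · rintro ⟨hne, h | h⟩
    · exact ⟨hne, h⟩
    · exact ⟨hne, touchT_symm h⟩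
  · rintro ⟨hne, h⟩
    exact ⟨hne, Or.inl h⟩

/-- box-touching blocks touch on the torus (`dist_T ≤ dist_X`): the admissible bonds of the fundamental box are admissible
bonds of the torus. [cite: Balaban1984PropagatorsII, (2.46) p.231, dictionary] -/
theorem bond_le_bondT : bond D.toDomains ≤ bondT D := by
  intro s t h
  obtain ⟨hne, x, x', hx, hx', hd⟩ := bond_adj.1 h
  exact bondT_adj.2 ⟨hne, x, x', hx, hx', (torusSupNorm_le_supNorm (one_le_of_mem x.2) _).trans hd⟩

/-- **ADMISSIBLE CONTOURS EXIST ON THE TORUS**: the bond graph is connected. [cite: Balaban1984PropagatorsII, (2.46) p.231] -/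
theorem connectedT (hMh : 1 ≤ Mh) (hP : ∀ μ, 1 ≤ P μ) : (bondT D).Connected :=
  (connected (D := D.toDomains) hMh hP).mono bond_le_bondT

variable (D)

/-- **THE GEOMETRY OF THE TORUS** as a `B6.Geometry`: sites `𝔅`, scale = level, `d` = the graph distance (2.46) of the
admissible bonds of the torus, `L`, `η = 1`. [cite: Balaban1984PropagatorsII, (2.45)–(2.46) p.231] -/
def geomT : B6.Geometry where
  Site := ↥(bset D.toDomains)
  fin := inferInstance
  scale := fun s => s.1.1
  dist := fun s t => ((bondT D).dist s t : ℝ)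
  k := k
  eta := 1
  L := (ℓ : ℝ) + 1
  R := 0
  M := 0
  Hyp21_22 := True
  Loc := Unit
  suppIn := fun _ _ => True
  supNorm := fun _ => 0
  l2Norm := fun _ => 0
  holder := fun _ _ => 0
  Cut := Unit
  cutIn := fun _ _ => True
  cutH := fun _ _ => 0
  cutSup := fun _ => 0

/-- the contour system realising `geomT D`. [cite: Balaban1984PropagatorsII, (2.46) p.231] -/
def csysT : ContourSystem (geomT D) := ⟨↥(bset D.toDomains), bondT D, id, fun s => s.1.1, fun _ => rfl⟩

/-- `geomT D` is realised by `csysT D`. [cite: Balaban1984PropagatorsII, (2.46) p.231] -/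
theorem realizesT : Realizes (geomT D) (csysT D) := fun _ _ => rfl

/-- **THE TORUS DISTANCE (2.46) IS AT MOST THE BOX DISTANCE** of the fundamental box (more admissible contours).
[cite: Balaban1984PropagatorsII, (2.46) p.231, dictionary] -/
theorem distT_le_dist_box (hMh : 1 ≤ Mh) (hP : ∀ μ, 1 ≤ P μ) (s t : ↥(bset D.toDomains)) :
    (bondT D).dist s t ≤ (bond D.toDomains).dist s t := by
  obtain ⟨p, hp⟩ := (connected (D := D.toDomains) hMh hP).exists_walk_length_eq_dist s t
  rw [← hp]
  have q := p.map (SimpleGraph.Hom.ofLE (bond_le_bondT (D := D)))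
  calc (bondT D).dist s t ≤ (p.map (SimpleGraph.Hom.ofLE (bond_le_bondT (D := D)))).length := SimpleGraph.dist_le _
    _ = p.length := SimpleGraph.Walk.length_map _ _

end Bonds

/-! ## §3 Positions on the real torus, the walk form of (2.2), the bond lengths and the packing -/

section LevelGapSec

variable {ℓ Mh k R : ℕ} {P : Fin (d + 1) → ℕ} {D : TDomains d ℓ Mh k P R}

/-- powers of `L` are monotone. [folklore] -/
private theorem powL_mono {a b : ℕ} (h : a ≤ b) : (((ℓ + 1) ^ a : ℕ) : ℝ) ≤ (((ℓ + 1) ^ b : ℕ) : ℝ) := by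
  exact_mod_cast Nat.pow_le_pow_right (by omega) h

variable (D) in
/-- **POSITIONS**: the class of the centre of a block on the real torus `Π_μ ℝ/N₀_μℤ`. [cite: Balaban1984PropagatorsII, (2.46) p.231, dictionary] -/
def posT (s : ↥(bset D.toDomains)) : TPt (N0 ℓ Mh k P) := toT (N0 ℓ Mh k P) (cen D.toDomains s)

/-- a site of a block is within `(L^j − 1)/2` of its position on the torus. [cite: Balaban1984PropagatorsII, (2.1) p.224, dictionary] -/
theorem dist_site_posT_le {x : ↥(boxDom (N0 ℓ Mh k P))} {s : ↥(bset D.toDomains)} (h : blkOf D.toDomains x = s) :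
    dist (toT (N0 ℓ Mh k P) (toR x.1)) (posT D s) ≤ ((((ℓ + 1) ^ s.1.1 : ℕ) : ℝ) - 1) / 2 :=
  (dist_toT_le (one_le_of_mem x.2) _ _).trans (dist_toR_cen_le D.toDomains h)

/-- **BOND LENGTHS ON THE TORUS**: the positions of two touching blocks are at most `L^{max level}` apart.
[cite: Balaban1984PropagatorsII, (2.46) p.231 («bonds of the lattice Λ_j»)] -/
theorem dist_posT_le_of_touchT {s t : ↥(bset D.toDomains)} (h : TouchT D s t) :
    dist (posT D s) (posT D t) ≤ (((ℓ + 1) ^ max s.1.1 t.1.1 : ℕ) : ℝ) := by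
  obtain ⟨x, x', hx, hx', hd⟩ := h
  have hN := one_le_of_mem x.2
  have h1 := dist_site_posT_le (D := D) hx
  have h2 := dist_site_posT_le (D := D) hx'
  have h12 : dist (toT (N0 ℓ Mh k P) (toR x.1)) (toT (N0 ℓ Mh k P) (toR x'.1)) ≤ 1 := by
    rw [dist_toT_toR hN]; exact hd
  have hs := powL_mono (ℓ := ℓ) (le_max_left s.1.1 t.1.1)
  have ht := powL_mono (ℓ := ℓ) (le_max_right s.1.1 t.1.1)
  calc dist (posT D s) (posT D t)
      ≤ dist (posT D s) (toT _ (toR x.1)) + dist (toT _ (toR x.1)) (toT _ (toR x'.1)) + dist (toT _ (toR x'.1)) (posT D t) :=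
        dist_triangle4 _ _ _ _
    _ ≤ ((((ℓ + 1) ^ s.1.1 : ℕ) : ℝ) - 1) / 2 + 1 + ((((ℓ + 1) ^ t.1.1 : ℕ) : ℝ) - 1) / 2 := by
        rw [dist_comm] at h1; linarith
    _ ≤ (((ℓ + 1) ^ max s.1.1 t.1.1 : ℕ) : ℝ) := by linarith

/-- bond lengths for adjacent blocks. [cite: Balaban1984PropagatorsII, (2.46) p.231] -/
theorem dist_posT_le_of_adj {s t : ↥(bset D.toDomains)} (h : (bondT D).Adj s t) :
    dist (posT D s) (posT D t) ≤ (((ℓ + 1) ^ max s.1.1 t.1.1 : ℕ) : ℝ) :=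
  dist_posT_le_of_touchT (bondT_adj.1 h).2

/-- **THE WALK INDUCTION BEHIND (2.2) ⇒ (2.57) ON THE TORUS**: a chain of admissible bonds from a block `a` of level `≤ i`
to a block of level `> i` reaches a SITE of level `≥ i + 1` within torus distance `|Γ|·L^i` of the position of `a`.
[cite: Balaban1984PropagatorsII, (2.2) p.224, (2.57) p.233] -/
theorem walk_dispT {i : ℕ} :
    ∀ {a x : ↥(bset D.toDomains)} (p : (bondT D).Walk a x), a.1.1 ≤ i → i < x.1.1 →
      ∃ t : ↥(boxDom (N0 ℓ Mh k P)), i + 1 ≤ D.lev t.1 ∧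
        dist (posT D a) (toT (N0 ℓ Mh k P) (toR t.1)) ≤ (p.length : ℝ) * (((ℓ + 1) ^ i : ℕ) : ℝ) := by
  intro a x p
  induction p with
  | nil => intro ha hx; omega
  | @cons a b e h p ih =>
    intro ha he
    have hLi : (1 : ℝ) ≤ (((ℓ + 1) ^ i : ℕ) : ℝ) := by exact_mod_cast Nat.one_le_pow _ _ (by omega)
    have hlen : (((SimpleGraph.Walk.cons h p).length : ℕ) : ℝ) = (p.length : ℝ) + 1 := by
      rw [SimpleGraph.Walk.length_cons]; push_cast; ring
    obtain ⟨hne, x₁, x₂, hx₁, hx₂, hd⟩ := bondT_adj.1 h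
    have hN := one_le_of_mem x₁.2
    have ha1 := powL_mono (ℓ := ℓ) ha
    by_cases hb : i < b.1.1
    · refine ⟨x₂, by rw [← D.toDomains_lev, lev_eq_of_blkOf_eq D.toDomains hx₂]; omega, ?_⟩
      have hd' : dist (toT (N0 ℓ Mh k P) (toR x₁.1)) (toT (N0 ℓ Mh k P) (toR x₂.1)) ≤ 1 := by
        rw [dist_toT_toR hN]; exact hd
      have h1 := dist_site_posT_le (D := D) hx₁
      rw [dist_comm] at h1
      calc dist (posT D a) (toT _ (toR x₂.1))
          ≤ dist (posT D a) (toT _ (toR x₁.1)) + dist (toT _ (toR x₁.1)) (toT _ (toR x₂.1)) := dist_triangle _ _ _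
        _ ≤ ((((ℓ + 1) ^ a.1.1 : ℕ) : ℝ) - 1) / 2 + 1 := by linarith
        _ ≤ (((ℓ + 1) ^ i : ℕ) : ℝ) := by linarith
        _ ≤ (((SimpleGraph.Walk.cons h p).length : ℕ) : ℝ) * (((ℓ + 1) ^ i : ℕ) : ℝ) := by
            rw [hlen]; nlinarith
    · push Not at hb
      obtain ⟨t, ht, hdist⟩ := ih hb he
      refine ⟨t, ht, ?_⟩
      have hab : dist (posT D a) (posT D b) ≤ (((ℓ + 1) ^ i : ℕ) : ℝ) :=
        (dist_posT_le_of_adj h).trans (powL_mono (max_le ha hb))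
      calc dist (posT D a) (toT _ (toR t.1)) ≤ dist (posT D a) (posT D b) + dist (posT D b) (toT _ (toR t.1)) :=
            dist_triangle _ _ _
        _ ≤ (((ℓ + 1) ^ i : ℕ) : ℝ) + (p.length : ℝ) * (((ℓ + 1) ^ i : ℕ) : ℝ) := add_le_add hab hdist
        _ = (((SimpleGraph.Walk.cons h p).length : ℕ) : ℝ) * (((ℓ + 1) ^ i : ℕ) : ℝ) := by rw [hlen]; ring

variable (D) in
/-- **THE WALK FORM OF (2.2) ON THE TORUS**: every chain of admissible bonds of the torus from a block of level `< i` to a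
block of level `> i` has at least `RM` bonds, `M = L·M_h` — from `B6MultiLevelTorusOperator.TDomains.sepT` (the TORUS distance in (2.2)) between the
corner of the starting block and the site reached by `walk_dispT`. [cite: Balaban1984PropagatorsII, (2.2) p.224, (2.57) p.233] -/
theorem levelGapT : LevelGap (bondT D) (fun s => s.1.1) (R * ((ℓ + 1) * Mh) - 1) := by
  intro i u x hu hx p
  obtain ⟨t, ht, hdist⟩ := walk_dispT p hu.le hx
  have hN := one_le_of_mem t.2
  -- `sepT` between the corner of `u` (level `< i`) and `t` (level `≥ i + 1`), in the torus distance
  have hsep := D.sepT i (corner D.toDomains u) (corner_mem D.toDomains u) t.1 t.2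
    (by rw [← D.toDomains_lev, lev_corner]; exact hu) ht
  rw [← dist_toT_toR hN] at hsep
  have hc₀ := dist_site_posT_le (D := D) (blkOf_corner D.toDomains u)
  dsimp only at hc₀
  have hc : dist (toT (N0 ℓ Mh k P) (toR (corner D.toDomains u))) (posT D u)
      ≤ ((((ℓ + 1) ^ u.1.1 : ℕ) : ℝ) - 1) / 2 := hc₀
  have hui : (((ℓ + 1) ^ u.1.1 : ℕ) : ℝ) ≤ (((ℓ + 1) ^ i : ℕ) : ℝ) := powL_mono hu.le
  have hLi : (0 : ℝ) < (((ℓ + 1) ^ i : ℕ) : ℝ) := by positivity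
  have hbig : ((R * bigSide ℓ Mh i : ℕ) : ℝ) = ((R * ((ℓ + 1) * Mh) : ℕ) : ℝ) * (((ℓ + 1) ^ i : ℕ) : ℝ) := by
    rw [bigSide_eq]; push_cast; ring
  have htot : ((R * ((ℓ + 1) * Mh) : ℕ) : ℝ) * (((ℓ + 1) ^ i : ℕ) : ℝ)
      < ((p.length : ℝ) + 1 / 2) * (((ℓ + 1) ^ i : ℕ) : ℝ) := by
    calc ((R * ((ℓ + 1) * Mh) : ℕ) : ℝ) * (((ℓ + 1) ^ i : ℕ) : ℝ) = ((R * bigSide ℓ Mh i : ℕ) : ℝ) := hbig.symm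
      _ < dist (toT _ (toR (corner D.toDomains u))) (toT _ (toR t.1)) := hsep
      _ ≤ dist (toT _ (toR (corner D.toDomains u))) (posT D u) + dist (posT D u) (toT _ (toR t.1)) :=
          dist_triangle _ _ _
      _ ≤ ((((ℓ + 1) ^ i : ℕ) : ℝ) - 1) / 2 + (p.length : ℝ) * (((ℓ + 1) ^ i : ℕ) : ℝ) := by linarith
      _ ≤ ((p.length : ℝ) + 1 / 2) * (((ℓ + 1) ^ i : ℕ) : ℝ) := by linarith
  have hlt : ((R * ((ℓ + 1) * Mh) : ℕ) : ℝ) < (p.length : ℝ) + 1 / 2 := lt_of_mul_lt_mul_right htot hLi.le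
  have hRM : R * ((ℓ + 1) * Mh) ≤ p.length := by
    have h' : ((R * ((ℓ + 1) * Mh) : ℕ) : ℝ) < ((p.length + 1 : ℕ) : ℝ) := by
      rw [Nat.cast_add, Nat.cast_one]; linarith
    have h'' : R * ((ℓ + 1) * Mh) < p.length + 1 := by exact_mod_cast h'
    exact Nat.lt_succ_iff.mp h''
  have hne : u ≠ x := fun h => by subst h; exact absurd (lt_trans hu hx) (lt_irrefl _)
  have h1 : 1 ≤ p.length := by
    rcases Nat.eq_zero_or_pos p.length with h0 | h0
    · exact absurd (SimpleGraph.Walk.eq_of_length_eq_zero h0) hne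
    · exact h0
  omega

/-- the label of a block of the fundamental box lies in `Π[0, N₀_μ/L^j)`. [cite: Balaban1984PropagatorsII, (2.1) p.224, dictionary] -/
theorem label_bounds (s : ↥(B6Geom246MultiLevelBoxL0.bset D.toDomains)) (μ : Fin (d + 1)) :
    0 ≤ s.1.2 μ ∧ s.1.2 μ < (N0 ℓ Mh k P μ : ℤ) / (((ℓ + 1) ^ s.1.1 : ℕ) : ℤ) := by
  obtain ⟨x, hx⟩ := exists_blkOf_eq D.toDomains s
  have hb := (blkOf_eq_iff_blk D.toDomains).1 hx
  have hxμ := (mem_boxDom.1 x.2) μ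
  have hL : (0 : ℤ) < (((ℓ + 1) ^ s.1.1 : ℕ) : ℤ) := by positivity
  have hdiv : (((ℓ + 1) ^ s.1.1 : ℕ) : ℤ) ∣ (N0 ℓ Mh k P μ : ℤ) := by
    have h1 : (ℓ + 1) ^ s.1.1 ∣ N0 ℓ Mh k P μ := by
      rw [N0_eq_bigSide_mul]
      exact Dvd.dvd.mul_right (B6MultiLevelTorusOperator.TDomains.pow_dvd_bigSide (le_trans (scale_bounds D.toDomains s).2 (Nat.le_succ k))) _
    exact_mod_cast h1
  have hsμ : s.1.2 μ = x.1 μ / (((ℓ + 1) ^ s.1.1 : ℕ) : ℤ) := by rw [← hb]; rfl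
  rw [hsμ]
  refine ⟨Int.ediv_nonneg hxμ.1 hL.le, ?_⟩
  obtain ⟨c, hc⟩ := hdiv
  rw [hc, Int.mul_ediv_cancel_left _ hL.ne']
  have : x.1 μ < (((ℓ + 1) ^ s.1.1 : ℕ) : ℤ) * c := by rw [← hc]; exact hxμ.2
  exact Int.ediv_lt_of_lt_mul hL (by rw [mul_comm]; exact this)

/-- every point of the real torus is the class of a real vector. [folklore] -/
private theorem exists_toT_eq (N : Fin (d + 1) → ℕ) (p : TPt N) : ∃ v : Fin (d + 1) → ℝ, toT N v = p := by
  have h : ∀ μ, ∃ r : ℝ, ((r : ℝ) : AddCircle ((N μ : ℕ) : ℝ)) = p μ := fun μ => QuotientAddGroup.mk_surjective (p μ)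
  choose v hv using h
  exact ⟨v, funext hv⟩

/-- **PER-LEVEL PACKING ON THE TORUS**: a finite set of level-`j` blocks whose positions lie within torus distance `r`
of a point has at most `(2r/L^j + 1)^{d+1}` elements (their labels, shifted by whole periods into one window of the
lattice `L^jℤ^{d+1}`, are distinct points of a cube of side `2r/L^j`). [cite: Balaban1984PropagatorsII, p.231 («the lattice Λ_j»), (2.58) p.233] -/
theorem packT (j : ℕ) (p : TPt (N0 ℓ Mh k P)) (r : ℝ) (S : Finset ↥(bset D.toDomains)) (hr : 0 ≤ r)
    (hS : ∀ s ∈ S, s.1.1 = j ∧ dist (posT D s) p ≤ r) :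
    ((#S : ℕ) : ℝ) ≤ (2 * r / (((ℓ + 1) ^ j : ℕ) : ℝ) + 1) ^ (d + 1) := by
  classical
  obtain ⟨pv, rfl⟩ := exists_toT_eq _ p
  set sℓ : ℝ := (((ℓ + 1) ^ j : ℕ) : ℝ) with hsℓ
  have hsℓ0 : 0 < sℓ := by rw [hsℓ]; positivity
  set p' : Fin (d + 1) → ℝ := fun μ => pv μ - (sℓ - 1) / 2 with hp'
  set lo : Fin (d + 1) → ℤ := fun μ => ⌈(p' μ - r) / sℓ⌉ with hlo
  set hi : Fin (d + 1) → ℤ := fun μ => ⌊(p' μ + r) / sℓ⌋ with hhi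
  set B : Finset (Fin (d + 1) → ℤ) := Fintype.piFinset fun μ => Finset.Icc (lo μ) (hi μ) with hB
  -- the period counted in level-`j` labels: `Q_μ = N₀_μ / L^j`
  set Q : Fin (d + 1) → ℤ := fun μ => (N0 ℓ Mh k P μ : ℤ) / (((ℓ + 1) ^ j : ℕ) : ℤ) with hQ
  -- the shifted label of a block
  set sh : ↥(bset D.toDomains) → (Fin (d + 1) → ℤ) := fun s μ =>
    s.1.2 μ - round ((((N0 ℓ Mh k P μ : ℕ) : ℝ))⁻¹ * (cen D.toDomains s μ - pv μ)) * Q μ with hsh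
  by_cases hSe : S = ∅
  · rw [hSe, Finset.card_empty, Nat.cast_zero]; positivity
  obtain ⟨s₀, hs₀⟩ := Finset.nonempty_of_ne_empty hSe
  have hjk : j ≤ k := by rw [← (hS s₀ hs₀).1]; exact (scale_bounds D.toDomains s₀).2
  have hdivN : ∀ μ, (((ℓ + 1) ^ j : ℕ) : ℤ) ∣ (N0 ℓ Mh k P μ : ℤ) := fun μ => by
    have h1 : (ℓ + 1) ^ j ∣ N0 ℓ Mh k P μ := by
      rw [N0_eq_bigSide_mul]
      exact Dvd.dvd.mul_right (B6MultiLevelTorusOperator.TDomains.pow_dvd_bigSide (le_trans hjk (Nat.le_succ k))) _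
    exact_mod_cast h1
  have hQN : ∀ μ, (((ℓ + 1) ^ j : ℕ) : ℤ) * Q μ = (N0 ℓ Mh k P μ : ℤ) := fun μ =>
    Int.mul_ediv_cancel' (hdivN μ)
  have hinj : Set.InjOn sh S := by
    intro s hs t ht hst
    have hsj := (hS s hs).1
    have htj := (hS t ht).1
    apply Subtype.ext
    refine Prod.ext (hsj.trans htj.symm) (funext fun μ => ?_)
    have e := congrFun hst μ
    simp only [hsh] at e
    -- both labels lie in `[0, Q_μ)` and agree modulo `Q_μ`
    obtain ⟨hs0, hs1⟩ := label_bounds (D := D) s μ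
    obtain ⟨ht0, ht1⟩ := label_bounds (D := D) t μ
    rw [hsj] at hs1; rw [htj] at ht1
    have hmod : s.1.2 μ % Q μ = t.1.2 μ % Q μ := by
      have h1 : s.1.2 μ = (s.1.2 μ - round ((((N0 ℓ Mh k P μ : ℕ) : ℝ))⁻¹ * (cen D.toDomains s μ - pv μ)) * Q μ)
          + Q μ * round ((((N0 ℓ Mh k P μ : ℕ) : ℝ))⁻¹ * (cen D.toDomains s μ - pv μ)) := by ring
      have h2 : t.1.2 μ = (t.1.2 μ - round ((((N0 ℓ Mh k P μ : ℕ) : ℝ))⁻¹ * (cen D.toDomains t μ - pv μ)) * Q μ)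
          + Q μ * round ((((N0 ℓ Mh k P μ : ℕ) : ℝ))⁻¹ * (cen D.toDomains t μ - pv μ)) := by ring
      rw [h1, Int.add_mul_emod_self_left, h2, Int.add_mul_emod_self_left, e]
    rwa [Int.emod_eq_of_lt hs0 hs1, Int.emod_eq_of_lt ht0 ht1] at hmod
  have hmaps : ∀ s ∈ S, sh s ∈ B := by
    intro s hs
    obtain ⟨hz, hdist⟩ := hS s hs
    rw [hB, Fintype.mem_piFinset]
    intro μ
    rw [Finset.mem_Icc]
    have hN1 : 1 ≤ N0 ℓ Mh k P μ := by
      obtain ⟨x, -⟩ := exists_blkOf_eq D.toDomains s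
      exact one_le_of_mem x.2 μ
    have hN0 : ((N0 ℓ Mh k P μ : ℕ) : ℝ) ≠ 0 := by positivity
    have hcoord : dist (posT D s μ) (toT (N0 ℓ Mh k P) pv μ) ≤ r := (dist_le_pi_dist _ _ μ).trans hdist
    rw [posT, toT, toT, dist_eq_norm, ← AddCircle.coe_sub, AddCircle.norm_eq] at hcoord
    -- the shifted centre is within `r` of `pv μ`
    set m : ℤ := round ((((N0 ℓ Mh k P μ : ℕ) : ℝ))⁻¹ * (cen D.toDomains s μ - pv μ)) with hm
    have hpos : cen D.toDomains s μ = sℓ * (s.1.2 μ : ℝ) + (sℓ - 1) / 2 := by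
      simp only [cen, hsℓ, hz]
    have hshμ : (sh s μ : ℝ) = (s.1.2 μ : ℝ) - (m : ℝ) * (Q μ : ℝ) := by
      simp only [hsh, hm]; push_cast; ring
    have hQr : sℓ * (Q μ : ℝ) = ((N0 ℓ Mh k P μ : ℕ) : ℝ) := by
      have := hQN μ; rw [hsℓ]; exact_mod_cast this
    have key : |sℓ * (sh s μ : ℝ) + (sℓ - 1) / 2 - pv μ| ≤ r := by
      have e : sℓ * (sh s μ : ℝ) + (sℓ - 1) / 2 - pv μ
          = cen D.toDomains s μ - pv μ - m * ((N0 ℓ Mh k P μ : ℕ) : ℝ) := by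
        rw [hshμ, hpos, ← hQr]; ring
      rw [e]; exact hcoord
    rw [abs_le] at key
    constructor
    · rw [hlo]
      refine Int.ceil_le.mpr ?_
      rw [div_le_iff₀ hsℓ0, hp']
      dsimp only
      linarith [key.1]
    · rw [hhi]
      refine Int.le_floor.mpr ?_
      rw [le_div_iff₀ hsℓ0, hp']
      dsimp only
      linarith [key.2]
  have hcardS : #S ≤ #B := Finset.card_le_card_of_injOn _ hmaps hinj
  have hcoordcard : ∀ μ, (#(Finset.Icc (lo μ) (hi μ)) : ℝ) ≤ 2 * r / sℓ + 1 := by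
    intro μ
    rw [Int.card_Icc]
    have h1 : ((hi μ + 1 - lo μ).toNat : ℝ) ≤ max ((hi μ : ℝ) + 1 - lo μ) 0 := by
      rcases le_or_gt 0 (hi μ + 1 - lo μ) with h | h
      · have e : ((hi μ + 1 - lo μ).toNat : ℝ) = (hi μ : ℝ) + 1 - lo μ := by
          exact_mod_cast Int.toNat_of_nonneg h
        rw [e]; exact le_max_left _ _
      · rw [Int.toNat_eq_zero.mpr h.le]; push_cast; exact le_max_right _ _
    refine h1.trans (max_le ?_ (by positivity))
    have hhi' : (hi μ : ℝ) ≤ (p' μ + r) / sℓ := Int.floor_le _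
    have hlo' : (p' μ - r) / sℓ ≤ (lo μ : ℝ) := Int.le_ceil _
    have : (p' μ + r) / sℓ - (p' μ - r) / sℓ = 2 * r / sℓ := by field_simp; ring
    linarith
  have hBcard : (#B : ℝ) ≤ (2 * r / sℓ + 1) ^ (d + 1) := by
    rw [hB, Fintype.card_piFinset]
    push_cast
    calc ∏ μ : Fin (d + 1), (#(Finset.Icc (lo μ) (hi μ)) : ℝ) ≤ ∏ _μ : Fin (d + 1), (2 * r / sℓ + 1) :=
          Finset.prod_le_prod (fun μ _ => Nat.cast_nonneg _) (fun μ _ => hcoordcard μ)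
      _ = (2 * r / sℓ + 1) ^ (d + 1) := by rw [Finset.prod_const, Finset.card_univ, Fintype.card_fin]
  calc ((#S : ℕ) : ℝ) ≤ #B := by exact_mod_cast hcardS
    _ ≤ (2 * r / sℓ + 1) ^ (d + 1) := hBcard

end LevelGapSec

/-! ## §4 Lemma 2.1 (2.60)–(2.63) on the torus -/

section Lemma21

variable {ℓ Mh k R : ℕ} {P : Fin (d + 1) → ℕ} (D : TDomains d ℓ Mh k P R)

/-- **[B6] LEMMA 2.1 FOR THE GENUINE NESTED FAMILY ON THE TORUS `T_η`**: for every `N₀ ≥ 1` with `N₀ + 1 ≤ RM`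
(`M = L·M_h`), `δ₀ ≥ 0`, `0 ≤ α ≤ 1` and `e^{−αδ₀}·L^{2(d+1)/N₀} < 1` ((2.59): «RM sufficiently large»), the geometry
`geomT D` satisfies (2.60), (2.61), (2.62), (2.63) with the constant `K261 N₀ (d+1) L 1 (αδ₀)` — the SAME constant as the
box lineage (`B6Geom246MultiLevelBoxL0.lemma21_box`) — by `B6Ineq261LevelGap.lemma21_of_realizes_max` on `csysT D` with
§2–§3 (positions on the real torus). [cite: Balaban1984PropagatorsII, Lemma 2.1 (2.60)–(2.63) p.234, (2.59) p.233, (2.2) p.224] -/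
theorem lemma21_torus (hMh : 1 ≤ Mh) (hP : ∀ μ, 1 ≤ P μ) {N₀ : ℕ} (hN₀ : 0 < N₀)
    (hRM : N₀ + 1 ≤ R * ((ℓ + 1) * Mh)) {δ₀ α : ℝ} (hδ₀ : 0 ≤ δ₀) (hα0 : 0 ≤ α) (hα1 : α ≤ 1)
    (hθ : Real.exp (-(α * δ₀)) * ((ℓ : ℝ) + 1) ^ ((2 * (d + 1 : ℕ) : ℝ) / N₀) < 1) :
    B6RandomWalk.Ineq260 (geomT D) δ₀ α
      ∧ B6Lemma21Repaired.Ineq261With (K261 N₀ (d + 1) ((ℓ : ℝ) + 1) 1 (α * δ₀)) (geomT D) δ₀ α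
      ∧ B6Lemma21Repaired.Ineq262With (K261 N₀ (d + 1) ((ℓ : ℝ) + 1) 1 (α * δ₀)) (geomT D) δ₀ α
      ∧ B6Lemma21Repaired.Ineq263With (K261 N₀ (d + 1) ((ℓ : ℝ) + 1) 1 (α * δ₀)) (geomT D) δ₀ α := by
  have hL1 : (1 : ℝ) ≤ (ℓ : ℝ) + 1 := by linarith [(Nat.cast_nonneg ℓ : (0 : ℝ) ≤ ℓ)]
  have hscl : ∀ n : ℕ, (((ℓ + 1) ^ n : ℕ) : ℝ) = ((ℓ : ℝ) + 1) ^ n := fun n => by push_cast; ring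
  refine lemma21_of_realizes_max (g := geomT D) (C := csysT D) (pos := posT D)
    (ℓ := fun n => (((ℓ + 1) ^ n : ℕ) : ℝ)) (N := N₀) (Lr := (ℓ : ℝ) + 1) (A := 1) (dd := d + 1)
    (realizesT D) Function.injective_id (connectedT hMh hP)
    (levelGap_of_le (levelGapT D) (by omega)) hN₀ (by simp [geomT]) (fun u v h => dist_posT_le_of_adj h)
    (fun a b h => powL_mono h) (fun n => by positivity) (fun n => ?_) hL1 zero_le_one
    (fun j p r S hr hS => packT j p r S hr hS) hδ₀ hα0 hα1 hθ
  show (((ℓ + 1) ^ (n + 1) : ℕ) : ℝ) ≤ ((ℓ : ℝ) + 1) * (((ℓ + 1) ^ n : ℕ) : ℝ)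
  rw [hscl, hscl, pow_succ]; ring_nf; exact le_rfl

/-- **(2.54), `d(y, y) = 0`, `d ≥ 0`** for `geomT D` (the chain's side hypotheses). [cite: Balaban1984PropagatorsII, (2.54) p.232, (2.46) p.231] -/
theorem triangle_refl_nonneg_T (hMh : 1 ≤ Mh) (hP : ∀ μ, 1 ≤ P μ) :
    B6RandomWalk.Triangle254 (geomT D) ∧ (∀ y : (geomT D).Site, (geomT D).dist y y = 0)
      ∧ (∀ y y' : (geomT D).Site, 0 ≤ (geomT D).dist y y') :=
  ⟨triangle254_of_realizes (realizesT D) (connectedT hMh hP), dist_self_of_realizes (realizesT D),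
    dist_nonneg_of_realizes (realizesT D)⟩

end Lemma21

/-! ## §5 Charts: the blocks of the chart family map onto the blocks of the torus, shortening no contour -/

section Chart

variable {ℓ Mh k R : ℕ} {P : Fin (d + 1) → ℕ} (D : TDomains d ℓ Mh k P R)

/-- **THE BLOCK MAP OF THE CHART `s`**: the block of a chart point goes to the torus block of the translated point
(read through the corner representative). [cite: Balaban1984PropagatorsII, (2.45) p.231, dictionary] -/
def blkMap (s : Fin (d + 1) → ℤ) (b : ↥(bset (D.chart s).toDomains)) : ↥(bset D.toDomains) :=
  blkOf D.toDomains (tshift (N0 ℓ Mh k P) (B6MultiLevelTorusOperator.TDomains.tvec ℓ Mh k s)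
    ⟨corner (D.chart s).toDomains b, corner_mem (D.chart s).toDomains b⟩)

variable {D}

/-- two chart points in one block are translated into one torus block. [cite: Balaban1984PropagatorsII, (2.45) p.231, dictionary] -/
theorem blkOf_tshift_eq (hMh : 1 ≤ Mh) (hP : ∀ μ, 1 ≤ P μ) (s : Fin (d + 1) → ℤ)
    {x x' : ↥(boxDom (N0 ℓ Mh k P))} (h : blkOf (D.chart s).toDomains x = blkOf (D.chart s).toDomains x') :
    blkOf D.toDomains (tshift (N0 ℓ Mh k P) (B6MultiLevelTorusOperator.TDomains.tvec ℓ Mh k s) x)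
      = blkOf D.toDomains (tshift (N0 ℓ Mh k P) (B6MultiLevelTorusOperator.TDomains.tvec ℓ Mh k s) x') := by
  have hval := congrArg Subtype.val h
  simp only [blkOf_val, Prod.mk.injEq, B6MultiLevelTorusOperatorL0.TDomains.toDomains_lev] at hval
  obtain ⟨hlev, hblk⟩ := hval
  -- levels: `lev_T(σ x) = lev_s(x)`
  have hl : D.lev (tshift (N0 ℓ Mh k P) (B6MultiLevelTorusOperator.TDomains.tvec ℓ Mh k s) x).1 = (D.chart s).lev x.1 := (D.chart_lev s x).symm
  have hl' : D.lev (tshift (N0 ℓ Mh k P) (B6MultiLevelTorusOperator.TDomains.tvec ℓ Mh k s) x').1 = (D.chart s).lev x'.1 := (D.chart_lev s x').symm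
  rw [← hlev] at hblk
  have hblk' := (blk_chart_iff hMh hP (le_trans ((D.chart s).lev_le x.1) (Nat.le_succ k)) s x' x).2 hblk
  apply Subtype.ext
  simp only [blkOf_val, B6MultiLevelTorusOperatorL0.TDomains.toDomains_lev]
  refine Prod.ext ?_ ?_
  · simp only [hl, hl', hlev]
  · simp only [hl, hl']
    rw [← hlev]
    exact hblk'

/-- **THE BLOCK MAP COMMUTES WITH `blkOf`**: `blkMap (blkOf_s x) = blkOf_T (σ_s x)`. [cite: Balaban1984PropagatorsII, (2.45) p.231, dictionary] -/
theorem blkMap_blkOf (hMh : 1 ≤ Mh) (hP : ∀ μ, 1 ≤ P μ) (s : Fin (d + 1) → ℤ) (x : ↥(boxDom (N0 ℓ Mh k P))) :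
    blkMap D s (blkOf (D.chart s).toDomains x)
      = blkOf D.toDomains (tshift (N0 ℓ Mh k P) (B6MultiLevelTorusOperator.TDomains.tvec ℓ Mh k s) x) := by
  unfold blkMap
  exact blkOf_tshift_eq hMh hP s (blkOf_corner (D.chart s).toDomains (blkOf (D.chart s).toDomains x))

/-- the block map is injective. [cite: Balaban1984PropagatorsII, (2.45) p.231, dictionary] -/
theorem blkMap_injective (hMh : 1 ≤ Mh) (hP : ∀ μ, 1 ≤ P μ) (s : Fin (d + 1) → ℤ) :
    Function.Injective (blkMap D s) := by
  intro b b' h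
  obtain ⟨x, rfl⟩ := exists_blkOf_eq (D.chart s).toDomains b
  obtain ⟨x', rfl⟩ := exists_blkOf_eq (D.chart s).toDomains b'
  rw [blkMap_blkOf hMh hP, blkMap_blkOf hMh hP] at h
  have hval := congrArg Subtype.val h
  simp only [blkOf_val, Prod.mk.injEq, B6MultiLevelTorusOperatorL0.TDomains.toDomains_lev] at hval
  obtain ⟨hlev, hblk⟩ := hval
  rw [← hlev, ← D.chart_lev s x] at hblk
  have hblk' := (blk_chart_iff hMh hP (le_trans ((D.chart s).lev_le x.1) (Nat.le_succ k)) s x' x).1 hblk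
  rw [← D.chart_lev s x, ← D.chart_lev s x'] at hlev
  apply Subtype.ext
  simp only [blkOf_val, B6MultiLevelTorusOperatorL0.TDomains.toDomains_lev]
  refine Prod.ext hlev ?_
  dsimp only
  rw [← hlev]
  exact hblk'

/-- the block map is surjective. [cite: Balaban1984PropagatorsII, (2.45) p.231, dictionary] -/
theorem blkMap_surjective (hMh : 1 ≤ Mh) (hP : ∀ μ, 1 ≤ P μ) (s : Fin (d + 1) → ℤ) :
    Function.Surjective (blkMap D s) := by
  intro t
  obtain ⟨y, rfl⟩ := exists_blkOf_eq D.toDomains t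
  refine ⟨blkOf (D.chart s).toDomains ((tshift (N0 ℓ Mh k P) (B6MultiLevelTorusOperator.TDomains.tvec ℓ Mh k s)).symm y), ?_⟩
  rw [blkMap_blkOf hMh hP, Equiv.apply_symm_apply]

/-- **THE BLOCK MAP IS A HOMOMORPHISM OF THE BOND GRAPHS** (box bonds of the chart ↦ torus bonds): touching chart blocks
are translated into touching torus blocks. [cite: Balaban1984PropagatorsII, (2.46) p.231, dictionary] -/
def blkHom (hMh : 1 ≤ Mh) (hP : ∀ μ, 1 ≤ P μ) (s : Fin (d + 1) → ℤ) : bond (D.chart s).toDomains →g bondT D where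
  toFun := blkMap D s
  map_rel' := by
    intro b b' h
    obtain ⟨hne, x, x', hx, hx', hd⟩ := bond_adj.1 h
    refine bondT_adj.2 ⟨fun he => hne (blkMap_injective hMh hP s he), ?_⟩
    refine ⟨tshift _ (B6MultiLevelTorusOperator.TDomains.tvec ℓ Mh k s) x, tshift _ (B6MultiLevelTorusOperator.TDomains.tvec ℓ Mh k s) x', ?_, ?_, ?_⟩
    · rw [← hx, blkMap_blkOf hMh hP]
    · rw [← hx', blkMap_blkOf hMh hP]
    · rw [torusSupNorm_tshift_sub]
      exact (torusSupNorm_le_supNorm (one_le_of_mem x.2) _).trans hd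

/-- **THE TORUS DISTANCE (2.46) IS AT MOST THE CHART'S BOX DISTANCE**: `d_T(blkOf_T(σ_s x), blkOf_T(σ_s x′)) ≤
d_s(blkOf_s x, blkOf_s x′)` — the inequality by which every decay bound proved in a chart is a decay bound on the torus.
[cite: Balaban1984PropagatorsII, (2.46) p.231, dictionary] -/
theorem distT_le_dist_chart (hMh : 1 ≤ Mh) (hP : ∀ μ, 1 ≤ P μ) (s : Fin (d + 1) → ℤ)
    (b b' : ↥(bset (D.chart s).toDomains)) :
    (bondT D).dist (blkMap D s b) (blkMap D s b') ≤ (bond (D.chart s).toDomains).dist b b' := by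
  obtain ⟨p, hp⟩ := (connected (D := (D.chart s).toDomains) hMh hP).exists_walk_length_eq_dist b b'
  rw [← hp]
  calc (bondT D).dist (blkMap D s b) (blkMap D s b') ≤ (p.map (blkHom hMh hP s)).length := SimpleGraph.dist_le _
    _ = p.length := SimpleGraph.Walk.length_map _ _

end Chart

end

end Literature.MathematicalPhysics.QuantumFieldTheory.Balaban1983to89.B6Geom246MultiLevelTorusL0
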